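import Summits.ResolutionOfSingularities.ResolutionOfSingularities.Theorems.WildConesCampaignW46HypersurfacesCharTwoFourfoldMultipleTangent

/-!
# [OURS · L1 W4.6, rung (ii) at p = 2, n = 4] ALL FOUR BRANCHES OF THE FOURFOLD ORDER-2-CLEANED CENSUS ARE INHABITED,
# over every field of characteristic 2: `e = 0` (`u₀u₁ + u₂u₃`: no infinitely-near double point), `(2,1)`
# (`u₀u₁ + u₂²u₃ + u₂u₃²`: three free near points), `(2,2)` (`u₀u₁ + u₂²u₃ + u₂u₃⁴`: satellite + free), `(2,3)`
# (`u₀u₁ + u₂⁵ + u₃⁵`: a non-isolated double successor)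

HONEST FRAMING. Everything here is OURS: theorems about route WildCones' own TYPED point-blow-up dynamics
(`Theorems/WildConesClassicalRegimesDefs.lean`) and the seat's invariants `milnorEmbDim` (p498937), `milnorHilbertTwo`
(p511581). NOTHING here is a statement of the manuscript [Hironaka2017]; no FACT-LIST premise; AI review is weaker than
expert review. Cell res-hironaka (LADDER-RESOLUTION rung L, D-0089), slot W4.6, seat res-L1-s46-pv-4 (gen 6); host route
`WildCones`, crux `ClassicalRegimes` (stmt-ResolutionOfSingularities-16884; proved).

WHY. `CampaignW46FourfoldsOrdTwoCensus` (p553632, proved at `p = 2` by p553129/p554453) lists the possible fates of an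
order-2-cleaned isolated double point of a fourfold hypersurface `z² = a(u₀,u₁,u₂,u₃)`: `e = 0`; `(e,h₂) = (2,1)`;
`(2,2)`; `(2,3)`. This file records that EACH branch occurs: the new witness `u₀u₁ + u₂u₃` (two hyperbolic pairs:
`(∂a) = 𝔪`, `μ = 1`, `e = 0`, no double successor in any chart) and the three gen-4/gen-6 witnesses (p517132,
p560817, the FourfoldMultipleTangent file).

WHAT IS PROVED: `fourPairs_…` lemmas (`MultP`, `OrdP`, `(∂a) = 𝔪`, `Isol`, `μ = 1`, `e = 0`, no double successor),
`fourfold_ordTwo_census_witnesses` (the four inhabited branches, over every field of characteristic `2`).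

References: [GreuelPfister2026] Thm 3.5 / Cor 3.7 (hyperbolic pairs: context); [Hironaka2017] Th. 16.6 p.84 — role
replaced only, under adjudication; nothing of it is used.
-/

noncomputable section

-- single-problem summit: the doubled namespace component `ResolutionOfSingularities` is forced
set_option linter.dupNamespace false

open scoped BigOperators Classical

open MvPowerSeries IsLocalRing

open Literature.AlgebraicGeometry.Resolution

namespace Summit.ResolutionOfSingularities.ResolutionOfSingularities.Theorems

namespace CampaignW46.HypersurfacesCharTwo

open WildCones WildCones.MuDropCharTwoOrdP ThreefoldsCharTwo

variable {κ : Type} [Field κ]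

/-! ## The witness `u₀u₁ + u₂u₃` (two hyperbolic pairs, `e = 0`) -/

/-- [OURS · L1 W4.6] Coefficients of `X₀X₁ + X₂X₃`. [folklore] -/
theorem coeff_fourPairs (A : Fin 4 →₀ ℕ) :
    coeff A ((X 0 * X 1 + X 2 * X 3 : MvPowerSeries (Fin 4) κ)) =
      (if A = Finsupp.single 0 1 + Finsupp.single 1 1 then 1 else 0) +
        (if A = Finsupp.single 2 1 + Finsupp.single 3 1 then 1 else 0) := by
  rw [map_add, X_def, X_def, X_def, X_def, monomial_mul_monomial, monomial_mul_monomial, one_mul, coeff_monomial,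
    coeff_monomial]

/-- [OURS · L1 W4.6] No monomial of `X₀X₁ + X₂X₃` has all exponents even. [folklore] -/
theorem fourPairs_coeff_eq_zero_of_even (A : Fin 4 →₀ ℕ) (hA : ∀ j, 2 ∣ A j) :
    coeff A ((X 0 * X 1 + X 2 * X 3 : MvPowerSeries (Fin 4) κ)) = 0 := by
  rw [coeff_fourPairs]
  have h0 : A ≠ Finsupp.single 0 1 + Finsupp.single 1 1 := by
    rintro rfl; have := hA 0; simp at this
  have h1 : A ≠ Finsupp.single 2 1 + Finsupp.single 3 1 := by
    rintro rfl; have := hA 2; simp at this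
  rw [if_neg h0, if_neg h1, add_zero]

/-- [OURS · L1 W4.6] The pair coefficient `[X₀X₁]` of `X₀X₁ + X₂X₃` is `1`. [folklore] -/
theorem coeff_pair_fourPairs :
    coeff (Finsupp.single 0 1 + Finsupp.single 1 1) ((X 0 * X 1 + X 2 * X 3 : MvPowerSeries (Fin 4) κ)) = 1 := by
  rw [coeff_fourPairs, if_pos rfl]
  have h1 : (Finsupp.single 0 1 + Finsupp.single 1 1 : Fin 4 →₀ ℕ) ≠ Finsupp.single 2 1 + Finsupp.single 3 1 := by
    intro h'; have := DFunLike.congr_fun h' 0; simp at this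
  rw [if_neg h1, add_zero]

/-- [OURS · L1 W4.6] A state (`n = 4`) with cleaned series `u₀u₁ + u₂u₃` is a double point, order-2 cleaned.
[folklore] -/
theorem multP_ordP_of_ser_eq_fourPairs {c : (Fin 4 → ℕ) → κ} (hc : ser 2 4 κ c = X 0 * X 1 + X 2 * X 3) :
    MultP 2 4 κ c ∧ OrdP 2 4 κ c := by
  constructor
  · rw [multP_iff_ser, hc]
    constructor
    · intro h
      have h1 := congrArg (coeff (Finsupp.single (0 : Fin 4) 1 + Finsupp.single 1 1)) h
      rw [coeff_pair_fourPairs, map_zero] at h1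
      exact one_ne_zero h1
    · refine nat_le_order fun d hd => ?_
      rw [coeff_fourPairs]
      have h0 : d ≠ Finsupp.single 0 1 + Finsupp.single 1 1 := by
        rintro rfl; simp only [map_add, Finsupp.degree_single] at hd; omega
      have h1 : d ≠ Finsupp.single 2 1 + Finsupp.single 3 1 := by
        rintro rfl; simp only [map_add, Finsupp.degree_single] at hd; omega
      rw [if_neg h0, if_neg h1, add_zero]
  · rw [ordP_two_iff_exists_pair, hc]
    exact ⟨0, 1, by decide, by rw [coeff_pair_fourPairs]; exact one_ne_zero⟩

/-- [OURS · L1 W4.6] In characteristic two (indeed any): `∂₀ = X₁`, `∂₁ = X₀`, `∂₂ = X₃`, `∂₃ = X₂` for `X₀X₁ + X₂X₃`.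
[folklore] -/
theorem pderiv_fourPairs (s : Fin 4) :
    MvPowerSeries.pderiv s ((X 0 * X 1 + X 2 * X 3 : MvPowerSeries (Fin 4) κ)) =
      if s = 0 then X 1 else if s = 1 then X 0 else if s = 2 then X 3 else X 2 := by
  rw [map_add, Derivation.leibniz, Derivation.leibniz, MvPowerSeries.pderiv_X, MvPowerSeries.pderiv_X,
    MvPowerSeries.pderiv_X, MvPowerSeries.pderiv_X]
  fin_cases s <;> simp [smul_eq_mul]

/-- [OURS · L1 W4.6] **The gradient ideal of `u₀u₁ + u₂u₃` is the maximal ideal.** [folklore] -/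
theorem jac_fourPairs_eq_maximalIdeal :
    Ideal.span (Set.range fun s : Fin 4 => MvPowerSeries.pderiv s ((X 0 * X 1 + X 2 * X 3 : MvPowerSeries (Fin 4) κ))) =
      maximalIdeal (MvPowerSeries (Fin 4) κ) := by
  apply le_antisymm
  · rw [Ideal.span_le]
    rintro _ ⟨s, rfl⟩
    dsimp only
    rw [SetLike.mem_coe, Literature.RingTheory.MvPowerSeries.Jets.mem_maximalIdeal_iff_constantCoeff_eq_zero,
      pderiv_fourPairs]
    fin_cases s <;> simp
  · -- `𝔪 = 𝔪¹` is spanned by the variables, each of which is a partial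
    have h := Literature.RingTheory.MvPowerSeries.Jets.maximalIdeal_pow_eq_span_monomial (σ := Fin 4) (K := κ) 1
    rw [pow_one] at h
    rw [h, Ideal.span_le]
    rintro _ ⟨e, he, rfl⟩
    change e.degree = 1 at he
    change (monomial e (1 : κ) : MvPowerSeries (Fin 4) κ) ∈ _
    obtain ⟨j, rfl⟩ := exists_eq_single_of_degree_eq_one he
    rw [← X_def]
    fin_cases j
    · exact Ideal.subset_span ⟨1, by dsimp only; rw [pderiv_fourPairs]; simp⟩
    · exact Ideal.subset_span ⟨0, by dsimp only; rw [pderiv_fourPairs]; simp⟩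
    · exact Ideal.subset_span ⟨3, by dsimp only; rw [pderiv_fourPairs]; simp⟩
    · exact Ideal.subset_span ⟨2, by dsimp only; rw [pderiv_fourPairs]; simp⟩

/-- [OURS · L1 W4.6 rung (ii) at `p = 2`, `n = 4`; NOT a statement of the manuscript] **`u₀u₁ + u₂u₃`: the `e = 0`
branch** — an order-2-cleaned isolated double point with `μ = 1`, `e = 0`, and NO infinitely-near double point in any
chart or translation (resolved by one blow-up). [folklore] -/
theorem fourPairs_census {c : (Fin 4 → ℕ) → κ} [CharP κ 2] (hc : ser 2 4 κ c = X 0 * X 1 + X 2 * X 3) :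
    MultP 2 4 κ c ∧ OrdP 2 4 κ c ∧ Isol 2 4 κ c ∧ mu 2 4 κ c = 1 ∧ milnorEmbDim 2 4 κ c = 0 ∧
      ∀ (i : Fin 4) (τ : Fin 4 → κ), ¬ MultP 2 4 κ (step 2 4 κ i τ c) := by
  obtain ⟨hM, hO⟩ := multP_ordP_of_ser_eq_fourPairs hc
  have hμ : mu 2 4 κ c = 1 := by
    rw [mu_eq_finrank_pderiv, hc,
      (Ideal.quotientEquivAlgOfEq κ (jac_fourPairs_eq_maximalIdeal (κ := κ))).toLinearEquiv.finrank_eq]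
    exact finrank_quot_maximalIdeal_eq_one 4
  have hI : Isol 2 4 κ c := by
    rw [isol_iff_finite_pderiv, hc, jac_fourPairs_eq_maximalIdeal]
    haveI := Literature.RingTheory.MvPowerSeries.Jets.finite_quotient_maximalIdeal_pow (σ := Fin 4) (K := κ) 1
    rw [← pow_one (maximalIdeal (MvPowerSeries (Fin 4) κ))]
    infer_instance
  have he : milnorEmbDim 2 4 κ c = 0 := (milnorEmbDim_eq_zero_iff hM).mpr ⟨hI, hμ⟩
  exact ⟨hM, hO, hI, hμ, he, hypersurface_not_multP_step_of_milnorEmbDim_eq_zero c hM he⟩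

/-! ## The four branches -/

/-- [OURS · L1 W4.6 rung (ii) at `p = 2`, `n = 4`; NOT a statement of the manuscript] **EVERY BRANCH OF THE FOURFOLD
ORDER-2-CLEANED CENSUS IS INHABITED**, over every field of characteristic `2`: there are order-2-cleaned isolated double
states of fourfold hypersurfaces with (a) `e = 0` and no infinitely-near double point (`u₀u₁ + u₂u₃`); (b) `e = 2`,
`h₂ = 1` and three double successors of corank `0` at pairwise non-proportional near vectors (`u₀u₁ + u₂²u₃ + u₂u₃²`,
p560817); (c) `e = 2`, `h₂ = 2`, a corank-two isolated double successor and a corank-zero one (`u₀u₁ + u₂²u₃ + u₂u₃⁴`);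
(d) `e = 2`, `h₂ = 3` and a NON-isolated double successor (`u₀u₁ + u₂⁵ + u₃⁵`, p517132). Non-vacuity of all cases of
`CampaignW46FourfoldsOrdTwoCensus` (p553632) at `p = 2`. [folklore] -/
theorem fourfold_ordTwo_census_witnesses (κ : Type) [Field κ] [CharP κ 2] :
    (∃ c : (Fin 4 → ℕ) → κ, MultP 2 4 κ c ∧ OrdP 2 4 κ c ∧ Isol 2 4 κ c ∧ milnorEmbDim 2 4 κ c = 0 ∧
      ∀ (i : Fin 4) (τ : Fin 4 → κ), ¬ MultP 2 4 κ (step 2 4 κ i τ c)) ∧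
    (∃ c : (Fin 4 → ℕ) → κ, MultP 2 4 κ c ∧ OrdP 2 4 κ c ∧ Isol 2 4 κ c ∧ milnorEmbDim 2 4 κ c = 2 ∧
      milnorHilbertTwo 2 4 κ c = 1 ∧
      (MultP 2 4 κ (step 2 4 κ 2 0 c) ∧ milnorEmbDim 2 4 κ (step 2 4 κ 2 0 c) = 0) ∧
      (MultP 2 4 κ (step 2 4 κ 3 0 c) ∧ milnorEmbDim 2 4 κ (step 2 4 κ 3 0 c) = 0) ∧
      (MultP 2 4 κ (step 2 4 κ 2 (Pi.single 3 1) c) ∧ milnorEmbDim 2 4 κ (step 2 4 κ 2 (Pi.single 3 1) c) = 0)) ∧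
    (∃ c : (Fin 4 → ℕ) → κ, MultP 2 4 κ c ∧ OrdP 2 4 κ c ∧ Isol 2 4 κ c ∧ milnorEmbDim 2 4 κ c = 2 ∧
      milnorHilbertTwo 2 4 κ c = 2 ∧
      (MultP 2 4 κ (step 2 4 κ 3 0 c) ∧ milnorEmbDim 2 4 κ (step 2 4 κ 3 0 c) = 2 ∧ Isol 2 4 κ (step 2 4 κ 3 0 c)) ∧
      (MultP 2 4 κ (step 2 4 κ 2 0 c) ∧ milnorEmbDim 2 4 κ (step 2 4 κ 2 0 c) = 0)) ∧
    (∃ c : (Fin 4 → ℕ) → κ, MultP 2 4 κ c ∧ OrdP 2 4 κ c ∧ Isol 2 4 κ c ∧ milnorEmbDim 2 4 κ c = 2 ∧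
      milnorHilbertTwo 2 4 κ c = 3 ∧ MultP 2 4 κ (step 2 4 κ 2 0 c) ∧ ¬ Isol 2 4 κ (step 2 4 κ 2 0 c)) := by
  refine ⟨?_, ?_, ?_, ?_⟩
  · obtain ⟨c, hc⟩ := exists_ser_eq (X 0 * X 1 + X 2 * X 3 : MvPowerSeries (Fin 4) κ) fourPairs_coeff_eq_zero_of_even
    obtain ⟨hM, hO, hI, -, he, hno⟩ := fourPairs_census hc
    exact ⟨c, hM, hO, hI, he, hno⟩
  · obtain ⟨c, hM, hO, hI, he, hh, -, h₁, h₂, h₃, -, -, -⟩ := fourfold_threeTangents_witness κ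
    exact ⟨c, hM, hO, hI, he, hh, h₁, h₂, h₃⟩
  · obtain ⟨c, hM, hO, hI, he, hh, ⟨hMs, hes, hIs, -⟩, hMf, hef, -⟩ := fourfold_multipleTangent_witness κ
    exact ⟨c, hM, hO, hI, he, hh, ⟨hMs, hes, hIs⟩, hMf, hef⟩
  · obtain ⟨c, hM, hI, he, hh, hM', hnI⟩ := (fourfold_hilbertTwo_witnesses κ).2
    exact ⟨c, hM, (ordP_iff_milnorEmbDim_add_two_le hM).mpr (by omega), hI, he, hh, hM', hnI⟩

end CampaignW46.HypersurfacesCharTwo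

end Summit.ResolutionOfSingularities.ResolutionOfSingularities.Theorems

end
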